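import Mathlib.MeasureTheory.Integral.IntervalIntegral.FundThmCalculus
import Literature.MathematicalPhysics.KineticTheory.InfiniteChainDynamicsProofs
import HarnessLib

/-!
# Lanford–Lebowitz–Lieb 1977, Theorem 3: the deterministic step (16) ⇒ (15)

Topic `Literature/MathematicalPhysics/KineticTheory`; proofs-only companion of
`InfiniteChainDynamics.lean` (named fact `OscillatorChain.LanfordLebowitzLieb1977_thm3_chain`, LLL
1977 §4 Thm 3) and of `InfiniteChainDynamicsProofs.lean` (proof of Thm 1, whose compactness and
passage-to-the-limit lemmas are reused here).

The printed proof of Theorem 3 (J. Stat. Phys. **16** (1977), pp. 459–460) has a probabilistic half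
(for `μ`-a.e. initial point `x` there are a constant `C` and arbitrarily large boxes `Λ` whose
severed orbits `T_t^Λ x` satisfy `∫ dt |p_i(T_t^Λ x)| / (1 + t²) ≤ C [log₊ i]^{1/2}` for all `i`; this
uses the invariance of Gibbs states under the severed flows and the Gaussian distribution of the
momenta) and a deterministic half, which is proved in this file
(`OscillatorChain.exists_isSolution_of_severed_bound`): from such a family of severed solutions,

* (16) `|q_i^Λ(t) - q_i| ≤ |∫_0^t p_i^Λ| ≤ (1 + t²) ∫ |p_i^Λ(s)| / (1 + s²) ds ≤ C (1 + t²) [log₊ i]^{1/2}`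
  for all `i`, `Λ`, `t` (`abs_sub_le_of_lintegral_le`);
* "since `F_i` depends only on a finite number of the `q_j`, and since each `V_j` is continuously
  differentiable, this bound implies a family of bounds of the form `|dp_i^Λ/dt| ≤ K_i(|t|)` where
  each `K_i` is a nondecreasing function of `t` which does not depend on `Λ`" (`forceSup`,
  `abs_sub_le_of_force_bound`);
* "the proof of the existence of solutions is now completed in the same way as in Theorem 1"
  (`exists_ultrafilter_tendsto_of_norm_le`, `isSolution_of_tendsto` of the Thm 1 file), and
  "(15) follows from (16) by passage to the limit".

Everything here is proved; no named facts. The weighted momentum integrals are written as lower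
Lebesgue integrals `∫⁻ s, ofReal (|p| / (1 + s²))` (no measurability or integrability hypothesis is
needed for the deterministic step). [cite: LanfordLebowitzLieb1977, §4 Thm 3, eqs. (15)–(16)]

## References

* O. E. Lanford III, J. L. Lebowitz, E. H. Lieb, *Time evolution of infinite anharmonic systems*,
  J. Stat. Phys. 16 (1977) 453–461, doi:10.1007/bf01152283, §4 Theorem 3. [LanfordLebowitzLieb1977]
-/

noncomputable section

open MeasureTheory Filter Topology Set Metric
open scoped ENNReal Interval

namespace Literature.MathematicalPhysics.KineticTheory.HeatConduction

namespace OscillatorChain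

variable {P : OscillatorChain}

/-! ### `log₊` -/

/-- LLL's `log₊ j = max (log |j|, 1)` (LLL 1977, §4, after eq. (15)). [cite: LanfordLebowitzLieb1977, §4 eq. (15)] -/
def logPlus (j : ℤ) : ℝ := max (Real.log |(j : ℝ)|) 1

/-- `1 ≤ log₊ j`. [folklore] -/
theorem one_le_logPlus (j : ℤ) : 1 ≤ logPlus j := le_max_right _ _

/-- `0 < log₊ j`. [folklore] -/
theorem logPlus_pos (j : ℤ) : 0 < logPlus j := lt_of_lt_of_le one_pos (one_le_logPlus j)

/-! ### (16): positions are controlled by the weighted momentum integral -/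

/-- **LLL (16).** If `q̇ = p` with `p` continuous and `∫ |p(s)| / (1 + s²) ds ≤ A`, then
`|q(t) - q(0)| ≤ (1 + t²) A` for every `t`. [cite: LanfordLebowitzLieb1977, §4 eq. (16)] -/
theorem abs_sub_le_of_lintegral_le {q p : ℝ → ℝ} (hq : ∀ s, HasDerivAt q (p s) s)
    (hpc : Continuous p) {A : ℝ} (hA : 0 ≤ A)
    (hp : ∫⁻ s, ENNReal.ofReal (|p s| / (1 + s ^ 2)) ≤ ENNReal.ofReal A) (t : ℝ) :
    |q t - q 0| ≤ (1 + t ^ 2) * A := by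
  have hftc : ∫ s in (0 : ℝ)..t, p s = q t - q 0 :=
    intervalIntegral.integral_eq_sub_of_hasDerivAt (fun s _ => hq s) (hpc.intervalIntegrable 0 t)
  have ht2 : 0 ≤ 1 + t ^ 2 := by positivity
  -- pointwise bound on `Ι 0 t`
  have hpt : ∀ s ∈ Ι (0 : ℝ) t, ENNReal.ofReal ‖p s‖ ≤
      ENNReal.ofReal (1 + t ^ 2) * ENNReal.ofReal (|p s| / (1 + s ^ 2)) := by
    intro s hs
    have hst : |s| ≤ |t| := by
      rcases Set.mem_uIoc.1 hs with h | h
      · rw [abs_of_pos h.1]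
        exact h.2.trans (le_abs_self t)
      · rw [abs_of_nonpos h.2]
        exact (neg_le_neg h.1.le).trans (neg_le_abs t)
    have hs2 : 1 + s ^ 2 ≤ 1 + t ^ 2 := by nlinarith [abs_nonneg s, sq_abs s, sq_abs t]
    have hs0 : 0 < 1 + s ^ 2 := by positivity
    rw [← ENNReal.ofReal_mul ht2, Real.norm_eq_abs]
    apply ENNReal.ofReal_le_ofReal
    rw [mul_div_assoc', le_div_iff₀ hs0]
    nlinarith [abs_nonneg (p s)]
  calc |q t - q 0| = ‖∫ s in (0 : ℝ)..t, p s‖ := by rw [hftc, Real.norm_eq_abs]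
    _ = ‖∫ s in Ι (0 : ℝ) t, p s‖ := intervalIntegral.norm_integral_eq_norm_integral_uIoc _
    _ ≤ (∫⁻ s in Ι (0 : ℝ) t, ENNReal.ofReal ‖p s‖).toReal := norm_integral_le_lintegral_norm _
    _ ≤ (ENNReal.ofReal (1 + t ^ 2) * ENNReal.ofReal A).toReal := by
        apply ENNReal.toReal_mono (ENNReal.mul_ne_top ENNReal.ofReal_ne_top ENNReal.ofReal_ne_top)
        calc ∫⁻ s in Ι (0 : ℝ) t, ENNReal.ofReal ‖p s‖
            ≤ ∫⁻ s in Ι (0 : ℝ) t,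
                ENNReal.ofReal (1 + t ^ 2) * ENNReal.ofReal (|p s| / (1 + s ^ 2)) :=
              setLIntegral_mono' measurableSet_uIoc hpt
          _ ≤ ∫⁻ s, ENNReal.ofReal (1 + t ^ 2) * ENNReal.ofReal (|p s| / (1 + s ^ 2)) :=
              lintegral_mono' Measure.restrict_le_self le_rfl
          _ = ENNReal.ofReal (1 + t ^ 2) * ∫⁻ s, ENNReal.ofReal (|p s| / (1 + s ^ 2)) :=
              lintegral_const_mul' _ _ ENNReal.ofReal_ne_top
          _ ≤ ENNReal.ofReal (1 + t ^ 2) * ENNReal.ofReal A := mul_le_mul_right hp _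
    _ = (1 + t ^ 2) * A := by
        rw [← ENNReal.ofReal_mul ht2, ENNReal.toReal_ofReal (mul_nonneg ht2 hA)]

/-- Momenta are controlled by a bound on the force along the orbit: if `ṗ = F` and `|F| ≤ M` on
`[0, t]`, then `|p(t) - p(0)| ≤ M |t|` (mean value inequality). [folklore] -/
theorem abs_sub_le_of_force_bound {p F : ℝ → ℝ} (hp : ∀ s, HasDerivAt p (F s) s) {M : ℝ} (t : ℝ)
    (hF : ∀ s ∈ uIcc 0 t, |F s| ≤ M) : |p t - p 0| ≤ M * |t| := by
  have h := (convex_uIcc (0 : ℝ) t).norm_image_sub_le_of_norm_hasDerivWithin_le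
    (fun s _ => (hp s).hasDerivWithinAt) (fun s hs => by simpa [Real.norm_eq_abs] using hF s hs)
    left_mem_uIcc right_mem_uIcc
  simpa [Real.norm_eq_abs] using h

/-! ### The force at a site as a continuous function of three positions -/

/-- The chain force at a site as a function of the positions `(q_{i-1}, q_i, q_{i+1})`:
`-U'(q_i) + V'(q_{i+1} - q_i) - V'(q_i - q_{i-1})` (LLL (1b)–(1c)). [cite: LanfordLebowitzLieb1977, §2 eqs. (1b)–(1c)] -/
def forceFun (P : OscillatorChain) (z : ℝ × ℝ × ℝ) : ℝ :=
  -deriv P.U z.2.1 + deriv P.V (z.2.2 - z.2.1) - deriv P.V (z.2.1 - z.1)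

/-- `F_i(σ) = forceFun (q_{i-1}, q_i, q_{i+1})`. [folklore] -/
theorem force_eq_forceFun (σ : ChainConfig) (i : ℤ) :
    P.force σ i = forceFun P ((σ (i - 1)).1, (σ i).1, (σ (i + 1)).1) := by
  simp only [forceFun, force_eq]

/-- `forceFun` is continuous when `U', V'` are. [folklore] -/
theorem continuous_forceFun (hUc : Continuous (deriv P.U)) (hVc : Continuous (deriv P.V)) :
    Continuous (forceFun P) := by
  unfold forceFun
  fun_prop

/-- The supremum of `|forceFun|` over the closed ball of radius `R` around `c` — LLL's `K_i`.
[folklore] -/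
def forceSup (P : OscillatorChain) (c : ℝ × ℝ × ℝ) (R : ℝ) : ℝ :=
  sSup ((fun z => |forceFun P z|) '' closedBall c R)

/-- `|forceFun z| ≤ forceSup c R` on the ball. [folklore] -/
theorem abs_forceFun_le_forceSup (hcont : Continuous (forceFun P)) {c : ℝ × ℝ × ℝ} {R : ℝ}
    {z : ℝ × ℝ × ℝ} (hz : z ∈ closedBall c R) : |forceFun P z| ≤ forceSup P c R :=
  le_csSup ((isCompact_closedBall c R).image (continuous_abs.comp hcont)).bddAbove
    (mem_image_of_mem _ hz)

/-- `forceSup c R` is nondecreasing in `R ≥ 0`. [folklore] -/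
theorem forceSup_mono (hcont : Continuous (forceFun P)) (c : ℝ × ℝ × ℝ) {R R' : ℝ} (hR : 0 ≤ R)
    (hRR' : R ≤ R') : forceSup P c R ≤ forceSup P c R' :=
  csSup_le_csSup ((isCompact_closedBall c R').image (continuous_abs.comp hcont)).bddAbove
    ((nonempty_closedBall.2 hR).image _) (image_mono (closedBall_subset_closedBall hRR'))

/-- `0 ≤ forceSup c R` for `R ≥ 0`. [folklore] -/
theorem forceSup_nonneg (hcont : Continuous (forceFun P)) (c : ℝ × ℝ × ℝ) {R : ℝ} (hR : 0 ≤ R) :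
    0 ≤ forceSup P c R :=
  (abs_nonneg _).trans (abs_forceFun_le_forceSup hcont (mem_closedBall_self hR))

/-! ### The deterministic half of Theorem 3 -/

/-- **LLL 1977, Theorem 3 — deterministic step.** Let `U', V'` be continuous, let `Λ_k` be finite
boxes eventually containing every site, and let `y_k` be severed solutions ((9a)–(9c) in `Λ_k`)
starting at `x` whose momenta satisfy `∫ |p_i(y_k(s))| / (1 + s²) ds ≤ C [log₊ i]^{1/2}` for all
`i ∈ Λ_k` and all `k`. Then there is a solution of (1a)–(1c) for all times starting at `x` with
`|q_i(t) - q_i| ≤ C (1 + t²) [log₊ i]^{1/2}` (LLL (16) ⇒ compactness as in Thm 1 ⇒ (15)). [cite: LanfordLebowitzLieb1977, §4 Thm 3, proof, eqs. (15)–(16)] -/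
theorem exists_isSolution_of_severed_bound (hUc : Continuous (deriv P.U))
    (hVc : Continuous (deriv P.V)) {x : ChainConfig} {C : ℝ} (hC : 0 ≤ C) {Λ : ℕ → Finset ℤ}
    (hΛ : ∀ j : ℤ, ∀ᶠ k in atTop, j ∈ Λ k) {y : ℕ → ℝ → ChainConfig} (hy0 : ∀ k, y k 0 = x)
    (hys : ∀ k, P.IsSeveredSolution (Λ k) (y k))
    (hyp : ∀ k, ∀ i ∈ Λ k, ∫⁻ s, ENNReal.ofReal (|(y k s i).2| / (1 + s ^ 2)) ≤
      ENNReal.ofReal (C * Real.sqrt (logPlus i))) :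
    ∃ γ : ℝ → ChainConfig, γ 0 = x ∧ P.IsSolution γ ∧
      ∀ (t : ℝ) (i : ℤ),
        |(γ t i).1 - (x i).1| ≤ C * (1 + t ^ 2) * Real.sqrt (max (Real.log |(i : ℝ)|) 1) := by
  have hcont : Continuous (forceFun P) := continuous_forceFun hUc hVc
  -- position radii (16), ball radii for the forces, force bounds, and the norm bounds `ρ`
  set r : ℝ → ℤ → ℝ := fun t j => C * (1 + t ^ 2) * Real.sqrt (logPlus j) with hr
  set c : ℤ → ℝ × ℝ × ℝ := fun i => ((x (i - 1)).1, (x i).1, (x (i + 1)).1) with hc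
  set R : ℝ → ℤ → ℝ := fun t i => r t (i - 1) + r t i + r t (i + 1) with hR
  set M : ℝ → ℤ → ℝ := fun t i => forceSup P (c i) (R t i) with hM
  set ρ : ℝ → ℤ → ℝ := fun t i => max (|(x i).1| + r t i) (|(x i).2| + M t i * |t|) with hρ
  have hr0 : ∀ t j, 0 ≤ r t j := fun t j => by positivity
  have hrm : ∀ j (s t : ℝ), |s| ≤ |t| → r s j ≤ r t j := fun j s t hst => by
    have : s ^ 2 ≤ t ^ 2 := by nlinarith [abs_nonneg s, sq_abs s, sq_abs t]
    simp only [hr]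
    gcongr
  have hR0 : ∀ t i, 0 ≤ R t i := fun t i => by positivity
  have hRm : ∀ i (s t : ℝ), |s| ≤ |t| → R s i ≤ R t i := fun i s t hst =>
    add_le_add (add_le_add (hrm _ s t hst) (hrm _ s t hst)) (hrm _ s t hst)
  have hM0 : ∀ t i, 0 ≤ M t i := fun t i => forceSup_nonneg hcont (c i) (hR0 t i)
  have hMm : ∀ i (s t : ℝ), |s| ≤ |t| → M s i ≤ M t i := fun i s t hst =>
    forceSup_mono hcont (c i) (hR0 s i) (hRm i s t hst)
  -- (16): position bounds, all sites, all boxes, all times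
  have hq : ∀ k t i, |(y k t i).1 - (x i).1| ≤ r t i := by
    intro k t i
    by_cases hi : i ∈ Λ k
    · have hd := fun s => ((hys k).1 i hi s)
      have hpc : Continuous fun s => (y k s i).2 :=
        continuous_iff_continuousAt.2 fun s => (hd s).2.continuousAt
      have h := abs_sub_le_of_lintegral_le (q := fun s => (y k s i).1) (p := fun s => (y k s i).2)
        (fun s => (hd s).1) hpc (by positivity : 0 ≤ C * Real.sqrt (logPlus i)) (hyp k i hi) t
      rw [hy0 k] at h
      calc |(y k t i).1 - (x i).1| ≤ (1 + t ^ 2) * (C * Real.sqrt (logPlus i)) := h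
        _ = r t i := by simp only [hr]; ring
    · rw [(hys k).2 i hi t, hy0 k, sub_self, abs_zero]
      exact hr0 t i
  -- force bounds along the orbits
  have hF : ∀ k t i, ∀ s ∈ uIcc (0 : ℝ) t, |P.force (y k s) i| ≤ M t i := by
    intro k t i s hs
    have hst : |s| ≤ |t| := by simpa using Set.abs_sub_left_of_mem_uIcc hs
    rw [force_eq_forceFun]
    refine abs_forceFun_le_forceSup hcont ?_
    rw [mem_closedBall]
    have h1 := (hq k s (i - 1)).trans (hrm _ s t hst)
    have h2 := (hq k s i).trans (hrm _ s t hst)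
    have h3 := (hq k s (i + 1)).trans (hrm _ s t hst)
    simp only [hc, Prod.dist_eq, Real.dist_eq]
    refine max_le (h1.trans ?_) (max_le (h2.trans ?_) (h3.trans ?_)) <;> simp only [hR] <;>
      linarith [hr0 t (i - 1), hr0 t i, hr0 t (i + 1)]
  -- momentum bounds
  have hp : ∀ k t i, |(y k t i).2 - (x i).2| ≤ M t i * |t| := by
    intro k t i
    by_cases hi : i ∈ Λ k
    · have h := abs_sub_le_of_force_bound (p := fun s => (y k s i).2) (F := fun s => P.force (y k s) i)
        (fun s => ((hys k).1 i hi s).2) t (hF k t i)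
      rw [hy0 k] at h
      exact h
    · rw [(hys k).2 i hi t, hy0 k, sub_self, abs_zero]
      exact mul_nonneg (hM0 t i) (abs_nonneg t)
  -- norm bounds, uniform in `k`, monotone in `|t|`
  have hρb : ∀ k t i, ‖y k t i‖ ≤ ρ t i := by
    intro k t i
    rw [Prod.norm_def, Real.norm_eq_abs, Real.norm_eq_abs]
    refine max_le_max ?_ ?_
    · have := hq k t i
      have e : (y k t i).1 = ((y k t i).1 - (x i).1) + (x i).1 := by ring
      rw [e]
      exact (abs_add_le _ _).trans (by linarith)
    · have := hp k t i
      have e : (y k t i).2 = ((y k t i).2 - (x i).2) + (x i).2 := by ring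
      rw [e]
      exact (abs_add_le _ _).trans (by linarith)
  have hρm : ∀ (i : ℤ) (s t : ℝ), |s| ≤ |t| → ρ s i ≤ ρ t i := by
    intro i s t hst
    refine max_le_max (add_le_add le_rfl (hrm i s t hst)) (add_le_add le_rfl ?_)
    exact mul_le_mul (hMm i s t hst) hst (abs_nonneg s) (hM0 t i)
  -- compactness: a pointwise limit along an ultrafilter
  obtain ⟨𝒰, w, h𝒰, -, hw⟩ := exists_ultrafilter_tendsto_of_norm_le
    (u := fun k (z : ℝ × ℤ) => y k z.1 z.2) (ρ := fun z => ρ z.1 z.2) (fun k z => hρb k z.1 z.2)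
  have hw' : ∀ (t : ℝ) (j : ℤ), Tendsto (fun k => y k t j) (𝒰 : Filter ℕ) (𝓝 (w (t, j))) :=
    fun t j => hw (t, j)
  refine ⟨fun t j => w (t, j), ?_, ?_, ?_⟩
  · -- initial condition
    funext j
    have h1 : Tendsto (fun k => y k 0 j) (𝒰 : Filter ℕ) (𝓝 (x j)) := by
      simp only [hy0]
      exact tendsto_const_nhds
    exact tendsto_nhds_unique (hw' 0 j) h1
  · -- equations of motion in the limit
    refine isSolution_of_tendsto hUc hVc hw' hρb hρm fun T j => ?_
    have hev : ∀ᶠ k : ℕ in (𝒰 : Filter ℕ), j ∈ Λ k := (hΛ j).filter_mono h𝒰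
    filter_upwards [hev] with k hk t _
    exact (hys k).1 j hk t
  · -- (15) in the limit
    intro t i
    have h1 : Tendsto (fun k => |(y k t i).1 - (x i).1|) (𝒰 : Filter ℕ)
        (𝓝 |(w (t, i)).1 - (x i).1|) :=
      ((continuous_abs.tendsto _).comp (((hw' t i).fst_nhds).sub tendsto_const_nhds))
    have h2 : |(w (t, i)).1 - (x i).1| ≤ r t i := le_of_tendsto' h1 fun k => hq k t i
    simpa only [hr, logPlus] using h2

end OscillatorChain

end Literature.MathematicalPhysics.KineticTheory.HeatConduction

end
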